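import Literature.NumberTheory.Rogawski1990.ArchTransfFamilyResolved     -- ★ (LH3-p04 (g3)): `contDiff_unit`, `continuous_slotPerm`, `contDiff_archERhoG_slotPerm`, tameness kit; brings ★ A1 (F0P3a-p09 (g5)) `prod_sign_update_swap_mul`
import Literature.NumberTheory.Rogawski1990.ArchBouazizStableFamilyJumpZero   -- ★ (LH10-p02 (g3)) (J-H): `HasOneSidedJump.const_mul`, `HasOneSidedJump.jump_congr` (reused, not restated)
import Literature.NumberTheory.Rogawski1990.ArchTransfFamilyJump         -- ★ p850158 (LH7-p02 (g2)) PART 1: `slotPerm_add_smul_nrm`; brings ★ `ArchHCSpaceG` (`hcNrm`, `hcCayPt`), ★ (COORD) `nrm`, `cayPt`, `RegG`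
import HarnessLib

/-!
# (I₃) for the candidate transfer family — PART 2a (KIT): one-sided jump calculus, the six slot relabellings at one place, the partner sum re-indexed `Σ_ρ = Σ_{ρ′} Σ_σ`,
# slot signs at a covered place, the normal curve through a `G`-semiregular wall point (Shelstad 1979 §4 Lemma 4.2–4.3; Rogawski 1990 §3.6, §4.3, §14.2)

Topic `NumberTheory/Rogawski1990`; namespace `Literature.NumberTheory.Rogawski1990`.  THEOREMS ONLY (no `def`, no instance, no notation, no axiom, no named fact, no `sorry`).
Cell `pub/hodgecm-mathlib`, line LH3 (closer stub `stub_N9`, crux H413 = `stmt-HodgeConjecture-24833`), organ **O-L2 (I₃-TRANSF)** ED. 1 (LH3-plan (g3) DEALER BOARD g3 #1 (iv),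
RULING #2; author LH7-p02 (g2)).  PART 2 proves the ORDER-0 JUMP of ★ `transfFam` at a covered wall (`= 2·jc′ S w₀ 0 2 ·` its Cayley value; file `ArchTransfFamilyJumpZero`); this file is its
combinatorial∕topological kit: §1 the `HasOneSidedJump` calculus (sums, continuous factors, — `const_mul`∕`jump_congr` are ★ LH10-p02's — reflection `ν ↦ −ν`, eventual equality off `0`); §2 the six elements of `S₃`, pure
relabellings `slotPerm (update 1 w₀ σ)`, the factorisation `ρ = ρ′·σ` (`ρ′ = update ρ w₀ 1`), the re-indexing `Σ_{ρ ∈ partnerPerms S} = Σ_{ρ′ ∈ partnerPerms (insert w₀ S)} Σ_{σ ∈ S₃}`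
and the count `#{σ | σ⁻¹1 ≠ 2} = 4` of the jumping classes; §3 the slot signs at a covered place (`slotSign 1 = slotSign 0 = −slotSign 2`), the `G`-regularity of the normal curve
`p + ν • nrm w₀` for small `ν ≠ 0`, semiregularity of the `w₀`-trivial partners, the reflected curve `(02)·(p + ν•nrm) = p − ν•nrm`.
HONEST LABEL: HC_CM is proved only modulo the 7 printed citations (2 remaining:
hLiu418 = `stmt-HodgeConjecture-24832`, h413 = `stmt-HodgeConjecture-24833`) until rung 0 closes; count-neutral.

## References
* [Shelstad1979] D. Shelstad, *Characters and inner forms of a quasi-split group over ℝ*, Compositio Math. 39 (1979), §4: Lemma 4.2 p. 23, Lemma 4.3 p. 25, Prop. 4.5 p. 26,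
  Thm. 4.7 (IIIb) p. 31.
* [Bouaziz1994IntegralesOrbitales] A. Bouaziz, *Intégrales orbitales sur les groupes de Lie réductifs*, Ann. Sci. ÉNS 27 (1994), §3.2 (I₁)–(I₃) pp. 579–580, §6.2 p. 591, Rem. 2 p. 594.
* [Rogawski1990] J. D. Rogawski, *Automorphic Representations of Unitary Groups in Three Variables* (1990), §3.6 p. 31, §4.3 (4.3.1) p. 43, §8.2 pp. 119–123, §14.2 p. 232.
* [Varadarajan1977] V. S. Varadarajan, *Harmonic Analysis on Real Reductive Groups*, LNM 576 (1977), Part I §1.12.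
-/

set_option autoImplicit false

noncomputable section

open NumberField NumberField.InfinitePlace Complex Set Filter Topology Equiv Finset
open scoped Classical Real ContDiff
open Literature.NumberTheory.Automorphic Literature.NumberTheory.Automorphic.UnitaryGroup Literature.NumberTheory.Automorphic.ArchCartan
open Literature.NumberTheory.Automorphic.Shelstad1979.StableOrbitalIntegrals
open Literature.NumberTheory.GaloisRepresentations

namespace Literature.NumberTheory.Rogawski1990

/-! ## §1 One-sided jump calculus (★ carpet `HasOneSidedJump`: sums, products with continuous factors, reflection, eventual equality) -/

section JumpCalculus

/-- Jumps add. [cite: Shelstad1979, §4 p. 22] -/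
theorem hasOneSidedJump_add {f g : ℝ → ℂ} {J J' : ℂ} (hf : HasOneSidedJump f J) (hg : HasOneSidedJump g J') :
    HasOneSidedJump (fun ν => f ν + g ν) (J + J') := by
  obtain ⟨Lp, Lm, hp, hm, hJ⟩ := hf
  obtain ⟨Lp', Lm', hp', hm', hJ'⟩ := hg
  exact ⟨Lp + Lp', Lm + Lm', hp.add hp', hm.add hm', by rw [← hJ, ← hJ']; ring⟩

/-- Finite sums of jumping functions jump by the sum of the jumps. [cite: Shelstad1979, §4 p. 22] -/
theorem hasOneSidedJump_sum {ι : Type*} (t : Finset ι) {f : ι → ℝ → ℂ} {J : ι → ℂ} (h : ∀ i ∈ t, HasOneSidedJump (f i) (J i)) :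
    HasOneSidedJump (fun ν => ∑ i ∈ t, f i ν) (∑ i ∈ t, J i) := by
  induction t using Finset.induction_on with
  | empty =>
    refine ⟨0, 0, ?_, ?_, sub_self 0⟩ <;> simpa only [Finset.sum_empty] using tendsto_const_nhds
  | insert a t ha ih =>
    simp only [Finset.sum_insert ha]
    exact hasOneSidedJump_add (h a (Finset.mem_insert_self a t)) (ih fun i hi => h i (Finset.mem_insert_of_mem hi))

/-- Negation. [cite: Shelstad1979, §4 p. 22] -/
theorem hasOneSidedJump_neg {f : ℝ → ℂ} {J : ℂ} (h : HasOneSidedJump f J) : HasOneSidedJump (fun ν => -f ν) (-J) := by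
  obtain ⟨Lp, Lm, hp, hm, hJ⟩ := h
  exact ⟨-Lp, -Lm, hp.neg, hm.neg, by rw [← hJ]; ring⟩

/-- **Product with a factor CONTINUOUS through `0`**: the jump is multiplied by the factor's value. [cite: Shelstad1979, §4 p. 25] -/
theorem hasOneSidedJump_mul_of_tendsto {A f : ℝ → ℂ} {a J : ℂ} (hA : Tendsto A (𝓝 (0 : ℝ)) (𝓝 a)) (h : HasOneSidedJump f J) :
    HasOneSidedJump (fun ν => A ν * f ν) (a * J) := by
  obtain ⟨Lp, Lm, hp, hm, hJ⟩ := h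
  exact ⟨a * Lp, a * Lm, (hA.mono_left nhdsWithin_le_nhds).mul hp, (hA.mono_left nhdsWithin_le_nhds).mul hm, by rw [← hJ, mul_sub]⟩

/-- **A function continuous through `0` has jump `0`.** [cite: Shelstad1979, §4 p. 23] -/
theorem hasOneSidedJump_zero_of_tendsto {f : ℝ → ℂ} {l : ℂ} (h : Tendsto f (𝓝 (0 : ℝ)) (𝓝 l)) : HasOneSidedJump f 0 :=
  ⟨l, l, h.mono_left nhdsWithin_le_nhds, h.mono_left nhdsWithin_le_nhds, sub_self l⟩

/-- **Reflection `ν ↦ −ν` negates the jump** (the two one-sided limits trade places). [cite: Shelstad1979, Lemma 4.3 p. 25] -/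
theorem hasOneSidedJump_comp_neg {f : ℝ → ℂ} {J : ℂ} (h : HasOneSidedJump f J) : HasOneSidedJump (fun ν => f (-ν)) (-J) := by
  obtain ⟨Lp, Lm, hp, hm, hJ⟩ := h
  have hnegp : Tendsto (fun ν : ℝ => -ν) (𝓝[>] (0 : ℝ)) (𝓝[<] 0) := by simpa using tendsto_neg_nhdsGT (a := (0 : ℝ))
  have hnegm : Tendsto (fun ν : ℝ => -ν) (𝓝[<] (0 : ℝ)) (𝓝[>] 0) := by simpa using tendsto_neg_nhdsLT (a := (0 : ℝ))
  exact ⟨Lm, Lp, hm.comp hnegp, hp.comp hnegm, by rw [← hJ]; ring⟩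

/-- **Eventual equality off `0` transports the jump** (both one-sided filters are below `𝓝[≠] 0`). [cite: Shelstad1979, §4 p. 22] -/
theorem hasOneSidedJump_congr_eventuallyEq {f g : ℝ → ℂ} {J : ℂ} (h : HasOneSidedJump f J) (hfg : ∀ᶠ ν in 𝓝[≠] (0 : ℝ), f ν = g ν) :
    HasOneSidedJump g J := by
  obtain ⟨Lp, Lm, hp, hm, hJ⟩ := h
  exact ⟨Lp, Lm, hp.congr' (hfg.filter_mono (nhdsGT_le_nhdsNE 0)), hm.congr' (hfg.filter_mono (nhdsLT_le_nhdsNE 0)), hJ⟩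

end JumpCalculus

/-! ## §2 Slot permutations at one place: the six elements of `S₃`, `ρ = ρ′·σ`, the partner sum re-indexed as `Σ_{ρ′} Σ_σ` -/

section Perms

variable {W : Type*} [DecidableEq W]

/-- The six elements of `S₃` (the slot relabellings at one compact place). [cite: Shelstad1979, Lemma 4.2 (p. 23)] -/
theorem perm_fin_three_eq (σ : Perm (Fin 3)) :
    σ = 1 ∨ σ = swap 0 1 ∨ σ = swap 0 2 ∨ σ = swap 1 2 ∨ σ = swap 0 2 * swap 0 1 ∨ σ = swap 0 1 * swap 0 2 := by
  revert σ
  decide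

/-- The four elements of `S₃` NOT sending slot `2` to slot `1` under `σ⁻¹` (the classes whose colliding pair `σ⁻¹{0,2}` contains the odd slot `2`: the four partner classes
adjacent to a noncompact wall). [cite: Shelstad1979, Thm. 4.7 (IIIb) p. 31] -/
theorem card_filter_perm_symm_one_ne_two : ((Finset.univ : Finset (Perm (Fin 3))).filter fun σ => σ.symm 1 ≠ 2).card = 4 := by
  decide

/-- A pure relabelling at `w₀`: `slotPerm (update 1 w₀ σ) c = update c w₀ (c w₀ ∘ σ)`. [cite: Shelstad1979, Lemma 4.2 (p. 23)] -/
theorem slotPerm_update_one (w₀ : W) (σ : Perm (Fin 3)) (c : W → Fin 3 → ℝ) :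
    slotPerm (Function.update (1 : W → Perm (Fin 3)) w₀ σ) c = Function.update c w₀ (c w₀ ∘ ⇑σ) := by
  funext v j
  by_cases hv : v = w₀
  · subst hv
    rw [slotPerm_apply, Function.update_self, Function.update_self, Function.comp_apply]
  · rw [slotPerm_apply, Function.update_of_ne hv, Function.update_of_ne hv, Pi.one_apply, Equiv.Perm.coe_one, id]

/-- Pure relabellings at `w₀` compose: `(σ·τ)` acts as `τ` after `σ` (★ `slotPerm_mul`). [cite: Shelstad1979, Lemma 4.2 (p. 23)] -/
theorem slotPerm_update_one_mul (w₀ : W) (σ τ : Perm (Fin 3)) (c : W → Fin 3 → ℝ) :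
    slotPerm (Function.update (1 : W → Perm (Fin 3)) w₀ (σ * τ)) c =
      slotPerm (Function.update (1 : W → Perm (Fin 3)) w₀ τ) (slotPerm (Function.update (1 : W → Perm (Fin 3)) w₀ σ) c) := by
  rw [← slotPerm_mul]
  congr 1
  funext v
  by_cases hv : v = w₀
  · subst hv
    rw [Pi.mul_apply, Function.update_self, Function.update_self, Function.update_self]
  · rw [Pi.mul_apply, Function.update_of_ne hv, Function.update_of_ne hv, Function.update_of_ne hv, Pi.one_apply, mul_one]

/-- **`ρ = ρ′·σ`**: every `ρ` factors as its `w₀`-trivial part `ρ′ = update ρ w₀ 1` followed by the pure relabelling `σ = ρ w₀` at `w₀`: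
`slotPerm ρ c = slotPerm (update 1 w₀ (ρ w₀)) (slotPerm (update ρ w₀ 1) c)`. [cite: Shelstad1979, Lemma 4.2 (p. 23)] -/
theorem slotPerm_eq_slotPerm_update_one (ρ : W → Perm (Fin 3)) (w₀ : W) (c : W → Fin 3 → ℝ) :
    slotPerm ρ c = slotPerm (Function.update (1 : W → Perm (Fin 3)) w₀ (ρ w₀)) (slotPerm (Function.update ρ w₀ 1) c) := by
  rw [← slotPerm_mul]
  congr 1
  funext v
  by_cases hv : v = w₀
  · subst hv
    rw [Pi.mul_apply, Function.update_self, Function.update_self, one_mul]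
  · rw [Pi.mul_apply, Function.update_of_ne hv, Function.update_of_ne hv, Pi.one_apply, mul_one]

/-- The `w₀`-trivial part of a point's partner curve: for `ρ′ w₀ = 1`, `slotPerm ρ′ (s + ν • nrm w₀) = slotPerm ρ′ s + ν • nrm w₀`. [cite: Shelstad1979, Lemma 4.2 (p. 23)] -/
theorem slotPerm_add_smul_nrm_of_apply_eq_one {ρ' : W → Perm (Fin 3)} {w₀ : W} (h : ρ' w₀ = 1) (s : W → Fin 3 → ℝ) (ν : ℝ) :
    slotPerm ρ' (s + ν • nrm w₀) = slotPerm ρ' s + ν • nrm w₀ := by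
  rw [slotPerm_add_smul_nrm, h, ← hcNrm_zero_two]
  rfl

/-- The Cayley point commutes with a `w₀`-trivial relabelling: `cayPt w₀ (slotPerm ρ′ c) = slotPerm ρ′ (cayPt w₀ c)` for `ρ′ w₀ = 1`. [cite: Shelstad1979, Lemma 4.3 (p. 25)] -/
theorem cayPt_slotPerm_of_apply_eq_one {ρ' : W → Perm (Fin 3)} {w₀ : W} (h : ρ' w₀ = 1) (c : W → Fin 3 → ℝ) :
    cayPt w₀ (slotPerm ρ' c) = slotPerm ρ' (cayPt w₀ c) := by
  funext v j
  by_cases hv : v = w₀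
  · subst hv
    simp only [cayPt, slotPerm_apply, Function.update_self, h, Equiv.Perm.coe_one, id_eq]
  · rw [cayPt_apply_of_ne hv, slotPerm_apply, slotPerm_apply, cayPt_apply_of_ne hv]

variable [Fintype W]

/-- `update ρ′ w₀ σ ∈ partnerPerms S` for `ρ′ ∈ partnerPerms (insert w₀ S)` (`w₀ ∉ S`). [cite: Shelstad1979, Lemma 4.2 (p. 23)] -/
theorem update_mem_partnerPerms_of_mem_insert {S : Finset W} {w₀ : W} (hw₀ : w₀ ∉ S) {ρ' : W → Perm (Fin 3)} (hρ' : ρ' ∈ partnerPerms (insert w₀ S))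
    (σ : Perm (Fin 3)) : Function.update ρ' w₀ σ ∈ partnerPerms S := by
  rw [mem_partnerPerms_iff] at hρ' ⊢
  intro w hw
  rw [Function.update_of_ne (by rintro rfl; exact hw₀ hw)]
  exact hρ' w (Finset.mem_insert_of_mem hw)

/-- `update ρ w₀ 1 ∈ partnerPerms (insert w₀ S)` for `ρ ∈ partnerPerms S`. [cite: Shelstad1979, Lemma 4.2 (p. 23)] -/
theorem update_one_mem_partnerPerms_insert {S : Finset W} (w₀ : W) {ρ : W → Perm (Fin 3)} (hρ : ρ ∈ partnerPerms S) :
    Function.update ρ w₀ 1 ∈ partnerPerms (insert w₀ S) := by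
  rw [mem_partnerPerms_iff] at hρ ⊢
  intro w hw
  by_cases h : w = w₀
  · subst h; rw [Function.update_self]
  · rw [Function.update_of_ne h]
    exact hρ w ((Finset.mem_insert.1 hw).resolve_left h)

/-- **The partner sum re-indexed at a compact place**: `Σ_{ρ ∈ partnerPerms S} f ρ = Σ_{ρ′ ∈ partnerPerms (insert w₀ S)} Σ_{σ ∈ S₃} f (update ρ′ w₀ σ)` (`w₀ ∉ S`; the bijection
`ρ ↦ (update ρ w₀ 1, ρ w₀)`). [cite: Shelstad1979, Lemma 4.2 (p. 23)] [cite: Rogawski1990, §4.3 (4.3.1) p. 43] -/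
theorem sum_partnerPerms_eq_sum_insert_sum_perm {M : Type*} [AddCommMonoid M] {S : Finset W} {w₀ : W} (hw₀ : w₀ ∉ S) (f : (W → Perm (Fin 3)) → M) :
    ∑ ρ ∈ partnerPerms S, f ρ = ∑ ρ' ∈ partnerPerms (insert w₀ S), ∑ σ : Perm (Fin 3), f (Function.update ρ' w₀ σ) := by
  rw [← Finset.sum_product (partnerPerms (insert w₀ S)) Finset.univ (fun x => f (Function.update x.1 w₀ x.2))]
  refine Finset.sum_bij' (fun ρ _ => (Function.update ρ w₀ 1, ρ w₀)) (fun x _ => Function.update x.1 w₀ x.2) ?_ ?_ ?_ ?_ ?_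
  · intro ρ hρ
    exact Finset.mem_product.2 ⟨update_one_mem_partnerPerms_insert w₀ hρ, Finset.mem_univ _⟩
  · intro x hx
    exact update_mem_partnerPerms_of_mem_insert hw₀ (Finset.mem_product.1 hx).1 x.2
  · intro ρ _
    simp only [Function.update_idem, Function.update_eq_self]
  · intro x hx
    have h1 : x.1 w₀ = 1 := eq_one_of_mem_partnerPerms (Finset.mem_product.1 hx).1 (Finset.mem_insert_self w₀ S)
    ext1
    · simp only [Function.update_idem]
      rw [← h1, Function.update_eq_self]
    · simp only [Function.update_self]
  · intro ρ _
    simp only [Function.update_idem, Function.update_eq_self]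

/-- **Counting the jumping classes**: `Σ_{ρ ∈ partnerPerms S} (if (ρ w₀)⁻¹ 1 ≠ 2 then Φ (update ρ w₀ 1) else 0) = 4 · Σ_{ρ′ ∈ partnerPerms (insert w₀ S)} Φ ρ′` (`w₀ ∉ S`).
[cite: Shelstad1979, Lemma 4.2 (p. 23); Thm. 4.7 (IIIb) p. 31] -/
theorem sum_partnerPerms_ite_symm_one_ne_two {S : Finset W} {w₀ : W} (hw₀ : w₀ ∉ S) (Φ : (W → Perm (Fin 3)) → ℂ) :
    ∑ ρ ∈ partnerPerms S, (if (ρ w₀).symm 1 ≠ 2 then Φ (Function.update ρ w₀ 1) else 0) = 4 * ∑ ρ' ∈ partnerPerms (insert w₀ S), Φ ρ' := by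
  rw [sum_partnerPerms_eq_sum_insert_sum_perm hw₀, Finset.mul_sum]
  refine Finset.sum_congr rfl fun ρ' hρ' => ?_
  have h1 : ρ' w₀ = 1 := eq_one_of_mem_partnerPerms hρ' (Finset.mem_insert_self w₀ S)
  have hrw : ∀ σ : Perm (Fin 3), (if (Function.update ρ' w₀ σ w₀).symm 1 ≠ 2 then Φ (Function.update (Function.update ρ' w₀ σ) w₀ 1) else 0) =
      if σ.symm 1 ≠ 2 then Φ ρ' else 0 := by
    intro σ
    rw [Function.update_self, Function.update_idem, ← h1, Function.update_eq_self]
  simp only [hrw]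
  rw [← Finset.sum_filter, Finset.sum_const, card_filter_perm_symm_one_ne_two, nsmul_eq_mul]
  norm_num

end Perms

/-! ## §3 The covered place: slot signs; the normal curve is `G`-regular off `ν = 0`; semiregularity of the partners; the compact reflection flips `'F` -/

section Covered

variable (L : Type) [Field L] [NumberField L] [IsCMField L] (α : Fin 3 → L)

omit [NumberField L] [IsCMField L] in
/-- **Slot signs at a covered place** (`w₀ ∈ splitChartPlaces`, house frame `α_i ≠ 0`): slots `0, 1` carry the same (majority) sign, slot `2` the opposite one, none is `0`.
[cite: Rogawski1990, §3.6 p. 31; §14.2 p. 232] -/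
theorem slotSign_of_mem_splitChartPlaces (hα : ∀ i, α i ≠ 0) {w₀ : {w : InfinitePlace L // IsComplex w}} (hcov : w₀ ∈ splitChartPlaces L α) :
    slotSign L α w₀ 1 = slotSign L α w₀ 0 ∧ slotSign L α w₀ 2 = -slotSign L α w₀ 0 ∧ slotSign L α w₀ 0 ≠ 0 := by
  have hreal : ∀ i, (w₀.1.embedding (α i)).im = 0 := hcov.1
  have hne : ∀ k, formSign L α w₀ k ≠ 0 := fun k h => formRe_ne_zero hα hreal k (sign_eq_zero_iff.1 h)
  have hind : ¬ (formSign L α w₀ 0 = formSign L α w₀ 1 ∧ formSign L α w₀ 1 = formSign L α w₀ 2) := by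
    rintro ⟨h01, h12⟩
    have hall : ∀ i, formSign L α w₀ i = formSign L α w₀ 0 := by
      intro i; fin_cases i
      · rfl
      · exact h01.symm
      · exact h12.symm.trans h01.symm
    have hsgn : SignType.sign (formRe L α w₀ (lineOf (formSign L α w₀) 0) * formRe L α w₀ (lineOf (formSign L α w₀) 2)) = -1 := sign_neg hcov.2
    rw [sign_mul] at hsgn
    change formSign L α w₀ (lineOf (formSign L α w₀) 0) * formSign L α w₀ (lineOf (formSign L α w₀) 2) = -1 at hsgn
    rw [hall (lineOf (formSign L α w₀) 0), hall (lineOf (formSign L α w₀) 2)] at hsgn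
    have h0 := hne 0
    revert hsgn h0
    generalize formSign L α w₀ 0 = t
    revert t; decide
  obtain ⟨h10, h20⟩ := sign_apply_lineOf (hne 0) (hne 1) (hne 2) hind
  exact ⟨h10, h20, hne _⟩

omit [NumberField L] [IsCMField L] in
/-- At a covered place the `(0, 2)` slot wall is NONCOMPACT (`slotSign 0 ≠ slotSign 2`) and the place is indefinite for `slotSign`. [cite: Rogawski1990, §14.2 p. 232] -/
theorem slotSign_zero_ne_two_of_mem_splitChartPlaces (hα : ∀ i, α i ≠ 0) {w₀ : {w : InfinitePlace L // IsComplex w}} (hcov : w₀ ∈ splitChartPlaces L α) :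
    slotSign L α w₀ 0 ≠ slotSign L α w₀ 2 ∧ IsIndefiniteAt (slotSign L α) w₀ := by
  obtain ⟨h10, h20, hne⟩ := slotSign_of_mem_splitChartPlaces L α hα hcov
  have h02 : slotSign L α w₀ 0 ≠ slotSign L α w₀ 2 := by
    rw [h20]
    revert hne; generalize slotSign L α w₀ 0 = t; revert t; decide
  exact ⟨h02, fun h => h02 (h10.symm.trans h.2)⟩

end Covered

section Curve

variable {W : Type*} [Fintype W] [DecidableEq W]

omit [Fintype W] [DecidableEq W] in
/-- A map on `Fin 3` with pairwise distinct values is injective. [folklore] -/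
private theorem injective_of_fin_three {X : Type*} {f : Fin 3 → X} (h01 : f 0 ≠ f 1) (h02 : f 0 ≠ f 2) (h12 : f 1 ≠ f 2) : Function.Injective f := by
  intro i j h
  fin_cases i <;> fin_cases j
  all_goals first
    | rfl
    | exact absurd h h01 | exact absurd h.symm h01 | exact absurd h h02 | exact absurd h.symm h02 | exact absurd h h12 | exact absurd h.symm h12

omit [Fintype W] in
/-- **The normal curve through a `G`-semiregular wall point is `G`-regular for small `ν ≠ 0`** (`w₀ ∉ S`; at `w₀` the three eigenvalues `e^{i(θ+ν)}, e^{iφ}, e^{i(θ−ν)}` separate).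
[cite: Shelstad1979, §4 p. 22; Lemma 4.3 p. 25] -/
theorem eventually_mem_regG_add_smul_nrm {S : Finset W} {w₀ : W} (hw₀ : w₀ ∉ S) {p : W → Fin 3 → ℝ} (hs02 : p w₀ 0 = p w₀ 2)
    (hs1 : Circle.exp (p w₀ 1) ≠ Circle.exp (p w₀ 0)) (hreg : ∀ v, v ∉ S → v ≠ w₀ → Function.Injective fun i : Fin 3 => Circle.exp (p v i))
    (hx : ∀ v ∈ S, p v 0 ≠ 0) : ∀ᶠ ν in 𝓝 (0 : ℝ), ν ≠ 0 → p + ν • nrm w₀ ∈ RegG S := by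
  have h1 : ∀ᶠ ν in 𝓝 (0 : ℝ), Circle.exp (p w₀ 0 + ν) ≠ Circle.exp (p w₀ 1) :=
    ContinuousAt.eventually_ne ((Circle.exp.continuous.comp (continuous_const.add continuous_id)).continuousAt) (by rw [add_zero]; exact hs1.symm)
  have h2 : ∀ᶠ ν in 𝓝 (0 : ℝ), Circle.exp (p w₀ 2 - ν) ≠ Circle.exp (p w₀ 1) :=
    ContinuousAt.eventually_ne ((Circle.exp.continuous.comp (continuous_const.sub continuous_id)).continuousAt) (by rw [sub_zero, ← hs02]; exact hs1.symm)
  filter_upwards [h1, h2, Ioo_mem_nhds (show (-1 : ℝ) < 0 by norm_num) (show (0 : ℝ) < 1 by norm_num)] with ν hν1 hν2 hν3 hν0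
  refine ⟨fun w hw => ?_, fun w hw => ?_⟩
  · by_cases hw0 : w = w₀
    · subst hw0
      rw [add_smul_nrm_apply_self]
      refine injective_of_fin_three ?_ ?_ ?_
      · simpa using hν1
      · simp only [Matrix.cons_val_zero, Matrix.cons_val_two, Matrix.tail_cons, Matrix.head_cons]
        intro h
        obtain ⟨m, hm⟩ := Circle.exp_eq_exp.1 h
        have hνm : ν = m * π := by linarith
        rcases eq_or_ne m 0 with hm0 | hm0
        · exact hν0 (by rw [hνm, hm0, Int.cast_zero, zero_mul])
        · have h1m : (1 : ℝ) ≤ |(m : ℝ)| := by rw [← Int.cast_abs]; exact_mod_cast Int.one_le_abs hm0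
          have hνabs : |ν| < 1 := abs_lt.2 ⟨hν3.1, hν3.2⟩
          rw [hνm, abs_mul, abs_of_pos Real.pi_pos] at hνabs
          nlinarith [Real.pi_gt_three]
      · simpa using hν2.symm
    · simp only [add_smul_nrm_apply_of_ne p ν hw0]
      exact hreg w hw hw0
  · rw [add_smul_nrm_apply_of_ne p ν (by rintro rfl; exact hw₀ hw)]
    exact hx w hw

omit [Fintype W] in
/-- The same, one-sidedly: `∀ᶠ ν in 𝓝[≠] 0`, both `p + ν • nrm w₀` and `p + (−ν) • nrm w₀` lie in `RegG S`. [cite: Shelstad1979, Lemma 4.3 p. 25] -/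
theorem eventually_nhdsNE_mem_regG_add_smul_nrm {S : Finset W} {w₀ : W} (hw₀ : w₀ ∉ S) {p : W → Fin 3 → ℝ} (hs02 : p w₀ 0 = p w₀ 2)
    (hs1 : Circle.exp (p w₀ 1) ≠ Circle.exp (p w₀ 0)) (hreg : ∀ v, v ∉ S → v ≠ w₀ → Function.Injective fun i : Fin 3 => Circle.exp (p v i))
    (hx : ∀ v ∈ S, p v 0 ≠ 0) :
    (∀ᶠ ν in 𝓝[≠] (0 : ℝ), p + ν • nrm w₀ ∈ RegG S) ∧ ∀ᶠ ν in 𝓝[≠] (0 : ℝ), p + (-ν) • nrm w₀ ∈ RegG S := by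
  have h := eventually_mem_regG_add_smul_nrm hw₀ hs02 hs1 hreg hx
  have hn : ∀ᶠ ν in 𝓝 (0 : ℝ), -ν ≠ 0 → p + (-ν) • nrm w₀ ∈ RegG S := (continuous_neg.tendsto' (0 : ℝ) 0 neg_zero).eventually h
  refine ⟨eventually_nhdsWithin_iff.2 ?_, eventually_nhdsWithin_iff.2 ?_⟩
  · filter_upwards [h] with ν hν hν0
    exact hν hν0
  · filter_upwards [hn] with ν hν hν0
    exact hν (neg_ne_zero.2 hν0)

/-- **A `w₀`-trivial partner of a semiregular wall point is a semiregular wall point** (`ρ′ ∈ partnerPerms (insert w₀ S)`). [cite: Shelstad1979, Lemma 4.2 (p. 23)] -/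
theorem semireg_slotPerm {S : Finset W} {w₀ : W} {ρ' : W → Perm (Fin 3)} (hρ' : ρ' ∈ partnerPerms (insert w₀ S)) {p : W → Fin 3 → ℝ}
    (hs02 : p w₀ 0 = p w₀ 2) (hs1 : Circle.exp (p w₀ 1) ≠ Circle.exp (p w₀ 0))
    (hreg : ∀ v, v ∉ S → v ≠ w₀ → Function.Injective fun i : Fin 3 => Circle.exp (p v i)) (hx : ∀ v ∈ S, p v 0 ≠ 0) :
    slotPerm ρ' p w₀ 0 = slotPerm ρ' p w₀ 2 ∧ Circle.exp (slotPerm ρ' p w₀ 1) ≠ Circle.exp (slotPerm ρ' p w₀ 0) ∧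
      (∀ v, v ∉ S → v ≠ w₀ → Function.Injective fun i : Fin 3 => Circle.exp (slotPerm ρ' p v i)) ∧ ∀ v ∈ S, slotPerm ρ' p v 0 ≠ 0 := by
  have h1 : ρ' w₀ = 1 := eq_one_of_mem_partnerPerms hρ' (Finset.mem_insert_self w₀ S)
  refine ⟨?_, ?_, fun v hv hne => ?_, fun v hv => ?_⟩
  · rw [slotPerm_apply_of_eq_one h1]; exact hs02
  · rw [slotPerm_apply_of_eq_one h1]; exact hs1
  · exact (hreg v hv hne).comp (ρ' v).injective
  · rw [slotPerm_apply_of_eq_one (eq_one_of_mem_partnerPerms hρ' (Finset.mem_insert_of_mem hv))]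
    exact hx v hv

omit [Fintype W] in
/-- The `(0, 2)` Cayley point IS ★ `cayPt`. [cite: Shelstad1979, §4 p. 25] -/
theorem hcCayPt_zero_two (w : W) (c : W → Fin 3 → ℝ) : hcCayPt w 0 2 c = cayPt w c := by
  rw [hcCayPt, cayPt, show hcThird (0 : Fin 3) 2 = 1 from by decide]

omit [Fintype W] in
/-- The `(0 2)`-relabelled normal curve is the REFLECTED normal curve: `slotPerm (update 1 w₀ (swap 0 2)) (p + ν • nrm w₀) = p + (−ν) • nrm w₀` on the wall `p_{w₀0} = p_{w₀2}`.
[cite: Shelstad1979, Lemma 4.3 p. 25] -/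
theorem slotPerm_update_one_swap_zero_two_add_smul_nrm {p : W → Fin 3 → ℝ} {w₀ : W} (hs02 : p w₀ 0 = p w₀ 2) (ν : ℝ) :
    slotPerm (Function.update (1 : W → Perm (Fin 3)) w₀ (swap 0 2)) (p + ν • nrm w₀) = p + (-ν) • nrm w₀ := by
  rw [slotPerm_update_one]
  funext v j
  by_cases hv : v = w₀
  · subst hv
    rw [Function.update_self, Function.comp_apply, add_smul_nrm_apply_self, add_smul_nrm_apply_self]
    fin_cases j
    · simp [Equiv.swap_apply_left, hs02]; ring
    · show (![p v 0 + ν, p v 1, p v 2 - ν] : Fin 3 → ℝ) ((swap (0 : Fin 3) 2) 1) = (![p v 0 + -ν, p v 1, p v 2 - -ν] : Fin 3 → ℝ) 1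
      rw [Equiv.swap_apply_of_ne_of_ne (by decide) (by decide)]
      simp
    · simp [Equiv.swap_apply_right, hs02]
  · rw [Function.update_of_ne hv, add_smul_nrm_apply_of_ne _ _ hv, add_smul_nrm_apply_of_ne _ _ hv]

end Curve

end Literature.NumberTheory.Rogawski1990

end
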